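import Literature.AlgebraicGeometry.AbelianVarieties.RelativeFourierExchange
import HarnessLib

/-!
# Exchange rows for Markman's `Φ = (id × Ψ_{𝒫⁻¹}) ∘ μ^*`: `D⁺(t_{(a,1)}^*) ⋙ Φ ≅ Φ ⋙ D⁺(t_{(a,1)}^*)`,
# `D⁺(pr₂^*P_α^∨ ⊗ –) ⋙ Φ ≅ Φ ⋙ D⁺(t_{(1,α)}^*)`, and their composite `… ≅ Φ ⋙ D⁺(t_{(a,α)}^*)` — the `e₂ ↦ e₁` bridge of the
# 2T sockets (Markman 2025 §6, §9.3; Mukai 1981 (3.1))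

Layer `Literature/AlgebraicGeometry/AbelianVarieties`; sequel to `MarkmanShearFourierFunctor` (`markmanPhiPlus A hΘ hK = D⁺(μ^*) ⋙ (id × Ψ_{𝒫^∨})`)
and `RelativeFourierExchange` (the two generic relative rows). For a principally polarised complex abelian variety `(A, Θ)`
(`Â = A.dualOf Θ hΘ`, `𝒫`, `P_α = linePt A hΘ hK α`) this file PROVES (0 named facts, no instances), as isomorphisms of FUNCTORS
`D⁺(Mod 𝒪_{A×A}) ⥤ D⁺(Mod 𝒪_{A×Â})`:

* §0 (generic `A`, `B`) the translation `t_p` of `A × B` as a scheme automorphism of `A.X ⊗ B.X` (`prodTranslationSchemeIso`), the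
  factorisation **`t_p = (t_{p₁} × 1) ≫ (1 × t_{p₂})`** and `(1 × t_{p₂})^* ⋙ (t_{p₁} × 1)^* ≅ t_p^*`;
* §1 the datum of the relative tensor row for the DUAL Poincaré kernel: **`(1 × t_α)^*𝒫^∨ ≅ 𝒫^∨ ⊗ p_A^*(P_α^∨)`** (Lange's Lemma 6.1.3
  at `(1, α)` in class currency, `detClass_dual`, `detClass_tensorObj_of_hasRank_one`, `nonempty_iso_iff_detClass_eq`; one CHOSEN
  representative, no normalisation asserted);
* §2 the shear COMMUTES with translations of the first factor (`(t_a × 1) ≫ μ = μ ≫ (t_a × 1)`, `A` commutative) and fixes the second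
  projection (`μ ≫ p₂ = p₂`), whence `(t_a × 1)^* ⋙ μ^* ≅ μ^* ⋙ (t_a × 1)^*` and `(p₂^*L ⊗ –) ⋙ μ^* ≅ μ^* ⋙ (p₂^*L ⊗ –)`;
* §3 **ROW Φ-(i) `markmanPhi_translationFst_iso : D⁺((t_a × 1)^*) ⋙ Φ ≅ Φ ⋙ D⁺((t_a × 1)^*)`**,
  **ROW Φ-(ii) `markmanPhi_twist_iso : D⁺(p₂^*(P_α^∨) ⊗ –) ⋙ Φ ≅ Φ ⋙ D⁺((1 × t_α)^*)`** (`P_α^∨ := Modules.dual (linePt A hΘ hK α)`, NOT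
  rewritten as `P_{α⁻¹}`), and their composite at a point `p = (a, α)` of `A × Â`,
  **ROW Φ-(iii) `markmanPhi_exchange_iso : D⁺(p₂^*(P_α^∨) ⊗ –) ⋙ D⁺((t_a × 1)^*) ⋙ Φ ≅ Φ ⋙ D⁺(t_p^*)`**, each with its objectwise
  `Nonempty` reading (instances discharged).

Print: "`Φ := (id × Ψ_{𝒫⁻¹[n]}) ∘ μ^*`" [Markman §6 p. 26 L51]; the conjugation of translations through `Φ̃` [§9.3 p. 71 L46–69].
The SHIFT `[n]` and the twist `[Θ ⊠ Θ] ⊗` of print are omitted as in `MarkmanShearFourierFunctor`. NOT here: rows in which a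
translation acts on the SECOND factor of `A × A` (through `μ` these become shears; they need the relative translation row, i.e. the
projection formula for `pr₁₃`); compatibilities between rows at different points; Mukai's Thm. 2.2. Typed for the cell `pub-hodge-ring2`
(plate F12 of crux 26512's (M1) library debt: with an iso `e₂ : Φ(X) ≅ Q𝓔`, ROW Φ-(iii) gives `Φ((t_a × 1)^*(p₂^*P_α^∨ ⊗ X)) ≅ t_p^*Q𝓔`
in `D⁺`, the `e₂ ↦ e₁` bridge); a research route conditional on HC_CM, not a corollary — nothing in this file refers to it.

## References

* E. Markman, *Cycles on abelian 2n-folds of Weil type…*, arXiv:2502.03415 (2025), §6 p. 26 L34–51, §9.3 p. 71 L46–69. [Markman2025SecantWeil]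
* S. Mukai, *Duality between `D(X)` and `D(X̂)`…*, Nagoya Math. J. 81 (1981), §3 (3.1) p. 158. [Mukai1981]
* H. Lange, *Abelian Varieties over the Complex Numbers* (2023), §6.1.1 Lemma 6.1.3, Lemma 6.1.2. [Lange2023AbelianVarietiesComplex]
* U. Görtz, T. Wedhorn, *Algebraic Geometry II* (2023), Def./Rem. 27.1 (p. 799). [GortzWedhorn2023]
* R. Hartshorne, *Algebraic Geometry* (1977), III Prop. 9.3. [Hartshorne1977]
-/

noncomputable section

-- `TopCat.Presheaf`/`Scheme.Modules` are not reducible (as in Mathlib's `AlgebraicGeometry/Modules/Sheaf.lean`).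
set_option backward.isDefEq.respectTransparency false

open CategoryTheory CategoryTheory.Limits AlgebraicGeometry MonoidalCategory CartesianMonoidalCategory
open AlgebraicGeometry.Scheme.Modules

universe w₁ w₂ w₃ u

namespace Literature.AlgebraicGeometry.AbelianVarieties

open Literature.AlgebraicGeometry.Motives Literature.AlgebraicGeometry.Modules
open scoped MonObj

variable (A : AbelianVariety ℂ) {Θ : CartierDivisor A.X.left} (hΘ : Θ.IsAmple) (hK : A.KTheta Θ = ⊥)

/-! ### §0 The translation `t_p` of `A × B` as a scheme automorphism of `A.X ⊗ B.X`, and `t_p = (t_{p₁} × 1) ≫ (1 × t_{p₂})` -/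

section ProdTranslationScheme

variable (B : AbelianVariety ℂ) (p : (A.prod B).Points ℂ)

/-- The translation `t_p` of `A × B` by a complex point `p`, as an automorphism of the underlying scheme of `A.X ⊗ B.X` (typed on the
tensor product, so that `Scheme.Modules.pullback (prodTranslationSchemeIso A B p).hom` composes with functors on `(A.X ⊗ B.X).left.Modules`).
[cite: GortzWedhorn2023, Def./Rem. 27.1 (p. 799)] -/
def prodTranslationSchemeIso : (A.X ⊗ B.X).left ≅ (A.X ⊗ B.X).left :=
  (Over.forget _).mapIso ((A.prod B).translationIso p)

/-- Unfolding: `(prodTranslationSchemeIso A B p).hom = (t_p).left`. [cite: GortzWedhorn2023, Def./Rem. 27.1 (p. 799)] -/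
theorem prodTranslationSchemeIso_hom : (prodTranslationSchemeIso A B p).hom = (prodTranslation A B p).left := rfl

/-- `t_p^*` is exact (pull-back along an isomorphism). [cite: Hartshorne1977, III Prop. 9.3] -/
theorem preservesFiniteLimits_pullback_prodTranslation :
    PreservesFiniteLimits (Scheme.Modules.pullback (prodTranslationSchemeIso A B p).hom) :=
  preservesFiniteLimits_pullback_of_iso _

/-- **`t_p = (t_{p₁} × 1) ≫ (1 × t_{p₂})` on `A × B`** (`p₁ = p ≫ pr₁`, `p₂ = p ≫ pr₂`; same components). [cite: GortzWedhorn2023, Def./Rem. 27.1 (p. 799)] -/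
theorem whiskerRight_translation_comp_whiskerLeft_translation :
    (A.translation (p ≫ fst A.X B.X) ▷ B.X) ≫ (A.X ◁ B.translation (p ≫ snd A.X B.X)) = prodTranslation A B p := by
  ext
  · rw [Category.assoc, whiskerLeft_fst, whiskerRight_fst, prodTranslation_comp_fst]
  · rw [Category.assoc, whiskerLeft_snd, ← Category.assoc, whiskerRight_snd, prodTranslation_comp_snd]

/-- The same on underlying schemes: `(fstTranslationIso A p₁ B).hom ≫ (sndTranslationIso B p₂ A).hom = (prodTranslationSchemeIso A B p).hom`.
[cite: GortzWedhorn2023, Def./Rem. 27.1 (p. 799)] -/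
theorem fstTranslationIso_hom_comp_sndTranslationIso_hom :
    (fstTranslationIso A (p ≫ fst A.X B.X) B).hom ≫ (sndTranslationIso B (p ≫ snd A.X B.X) A).hom =
      (prodTranslationSchemeIso A B p).hom := by
  change (A.translation (p ≫ fst A.X B.X) ▷ B.X).left ≫ (A.X ◁ B.translation (p ≫ snd A.X B.X)).left = (prodTranslation A B p).left
  rw [← Over.comp_left, whiskerRight_translation_comp_whiskerLeft_translation]

/-- `(1 × t_{p₂})^* ⋙ (t_{p₁} × 1)^* ≅ t_p^*` on `Mod 𝒪_{A×B}`. [cite: GortzWedhorn2023, Def./Rem. 27.1 (p. 799)] -/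
def pullbackSndTranslationFstTranslationIso :
    Scheme.Modules.pullback (sndTranslationIso B (p ≫ snd A.X B.X) A).hom ⋙
        Scheme.Modules.pullback (fstTranslationIso A (p ≫ fst A.X B.X) B).hom ≅
      Scheme.Modules.pullback (prodTranslationSchemeIso A B p).hom :=
  pullbackComp _ _ ≪≫ pullbackCongr (fstTranslationIso_hom_comp_sndTranslationIso_hom A B p)

end ProdTranslationScheme

/-! ### §1 `(1 × t_α)^*𝒫^∨ ≅ 𝒫^∨ ⊗ p_A^*(P_α^∨)` -/

section Datum

variable (α : (A.dualOf Θ hΘ).Points ℂ)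

/-- `1_A × t_α = t_{(1,α)}` on `A × Â` (whiskering vs translation of the product: same components). [cite: GortzWedhorn2023, Def./Rem. 27.1 (p. 799)] -/
theorem whiskerLeft_translation_eq_prodTranslation :
    A.X ◁ (A.dualOf Θ hΘ).translation α = prodTranslation A (A.dualOf Θ hΘ) (unitProdPoint A hΘ α) := by
  ext
  · rw [whiskerLeft_fst, prodTranslation_comp_fst, unitProdPoint_comp_fst, AbelianVariety.translation_one, Category.comp_id]
  · rw [whiskerLeft_snd, prodTranslation_comp_snd, unitProdPoint_comp_snd]

/-- `(1 × t_α).hom = t_{(1,α)}` on underlying schemes. [cite: GortzWedhorn2023, Def./Rem. 27.1 (p. 799)] -/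
theorem sndTranslationIso_hom_eq :
    (sndTranslationIso (A.dualOf Θ hΘ) α A).hom = (unitProdTranslationIso A hΘ α).hom := by
  change (A.X ◁ (A.dualOf Θ hΘ).translation α).left = (prodTranslation A (A.dualOf Θ hΘ) (unitProdPoint A hΘ α)).left
  rw [whiskerLeft_translation_eq_prodTranslation]

/-- **Lange 6.1.3 for the DUAL kernel at `(1, α)`: `(1 × t_α)^*𝒫^∨ ≅ 𝒫^∨ ⊗ p_A^*(P_α^∨)`** in `tensorObj` currency (classes:
`(1 × t_α)^*[𝒫]⁻¹ = ([𝒫]·p_A^*[P_α])⁻¹ = [𝒫]⁻¹·p_A^*[P_α]⁻¹`). [cite: Lange2023AbelianVarietiesComplex, §6.1.1 Lemma 6.1.3 and Lemma 6.1.2]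
[cite: Mukai1981, §3 p. 158 L6–8] -/
theorem nonempty_pullback_sndTranslation_dualPoincareSheaf_iso :
    Nonempty ((Scheme.Modules.pullback (sndTranslationIso (A.dualOf Θ hΘ) α A).hom).obj (Modules.dual (poincareSheaf A hΘ hK)) ≅
      tensorObj (Modules.dual (poincareSheaf A hΘ hK))
        ((Scheme.Modules.pullback (fst A.X (A.dualOf Θ hΘ).X).left).obj (Modules.dual (linePt A hΘ hK α)))) := by
  have h𝒫 := isFiniteLocallyFree_poincareSheaf A hΘ hK
  have h𝒫₁ := hasRank_poincareSheaf A hΘ hK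
  have hP := isFiniteLocallyFree_linePt A hΘ hK α
  have hP₁ := hasRank_linePt A hΘ hK α
  have hD := isFiniteLocallyFree_dual h𝒫
  have hD₁ := hasRank_dual h𝒫₁
  have hQ := isFiniteLocallyFree_dual hP
  have hQ₁ := hasRank_dual hP₁
  refine (nonempty_iso_iff_detClass_eq (hasRank_pullback _ hD₁) (hasRank_tensorObj_one hD₁ (hasRank_pullback _ hQ₁))
    (hD.pullback _) (isFiniteLocallyFree_tensorObj _ _ hD (hQ.pullback _))).2 ?_
  rw [detClass_pullback _ hD, detClass_tensorObj_of_hasRank_one hD₁ (hasRank_pullback _ hQ₁) hD (hQ.pullback _),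
    detClass_pullback _ hQ, detClass_dual h𝒫, detClass_dual hP, sndTranslationIso_hom_eq, unitProdTranslationIso_hom, map_inv,
    pullback_prodTranslation_detClass_poincareSheaf, unitProdPoint_comp_snd, unitProdPoint_comp_fst, detClass_linePtHat_one,
    map_one, mul_one, mul_inv, map_inv]

/-- A chosen isomorphism `(1 × t_α)^*𝒫^∨ ≅ 𝒫^∨ ⊗ p_A^*(P_α^∨)`. [cite: Lange2023AbelianVarietiesComplex, §6.1.1 Lemma 6.1.3] -/
def pullbackSndTranslationDualPoincareSheafIso :
    (Scheme.Modules.pullback (sndTranslationIso (A.dualOf Θ hΘ) α A).hom).obj (Modules.dual (poincareSheaf A hΘ hK)) ≅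
      tensorObj (Modules.dual (poincareSheaf A hΘ hK))
        ((Scheme.Modules.pullback (fst A.X (A.dualOf Θ hΘ).X).left).obj (Modules.dual (linePt A hΘ hK α))) :=
  (nonempty_pullback_sndTranslation_dualPoincareSheaf_iso A hΘ hK α).some

end Datum

/-! ### §2 The shear commutes with `t_a × 1` and fixes `p₂` -/

section Shear

variable (a : A.Points ℂ)

/-- **`(t_a × 1) ≫ μ = μ ≫ (t_a × 1)`** (`A` is commutative: `μ(a x₁, x₂) = (a x₁ x₂, x₂)`). [cite: Markman2025SecantWeil, §6 p. 26 L34] -/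
theorem whiskerRight_translation_comp_shear :
    (A.translation a ▷ A.X) ≫ (shearIso A).hom = (shearIso A).hom ≫ (A.translation a ▷ A.X) := by
  ext
  · rw [Category.assoc, shearIso_hom_comp_fst, MonObj.comp_mul, whiskerRight_fst, whiskerRight_snd, Category.assoc,
      whiskerRight_fst, ← Category.assoc, shearIso_hom_comp_fst, AbelianVariety.comp_translation_eq_mul,
      AbelianVariety.comp_translation_eq_mul, mul_assoc]
  · rw [Category.assoc, shearIso_hom_comp_snd, whiskerRight_snd, Category.assoc, whiskerRight_snd, shearIso_hom_comp_snd]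

/-- The same on underlying schemes. [cite: Markman2025SecantWeil, §6 p. 26 L34] -/
theorem fstTranslationIso_hom_comp_shear :
    (fstTranslationIso A a A).hom ≫ (shearSchemeIso A).hom = (shearSchemeIso A).hom ≫ (fstTranslationIso A a A).hom := by
  change (A.translation a ▷ A.X).left ≫ (shearIso A).hom.left = (shearIso A).hom.left ≫ (A.translation a ▷ A.X).left
  rw [← Over.comp_left, ← Over.comp_left, whiskerRight_translation_comp_shear]

/-- `μ ≫ p₂ = p₂` on underlying schemes. [cite: Markman2025SecantWeil, §6 p. 26 L34] -/
theorem shearSchemeIso_hom_comp_snd : (shearSchemeIso A).hom ≫ (snd A.X A.X).left = (snd A.X A.X).left := by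
  change (shearIso A).hom.left ≫ (snd A.X A.X).left = _
  rw [← Over.comp_left, shearIso_hom_comp_snd]

/-- `(t_a × 1)^* ⋙ μ^* ≅ μ^* ⋙ (t_a × 1)^*`. [cite: Markman2025SecantWeil, §6 p. 26 L34] -/
def pullbackFstTranslationShearIso :
    Scheme.Modules.pullback (fstTranslationIso A a A).hom ⋙ Scheme.Modules.pullback (shearSchemeIso A).hom ≅
      Scheme.Modules.pullback (shearSchemeIso A).hom ⋙ Scheme.Modules.pullback (fstTranslationIso A a A).hom :=
  pullbackComp _ _ ≪≫ pullbackCongr (fstTranslationIso_hom_comp_shear A a).symm ≪≫ (pullbackComp _ _).symm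

/-- `(p₂^*L ⊗ –) ⋙ μ^* ≅ μ^* ⋙ (p₂^*L ⊗ –)` for `L` finite locally free on `A` (`μ ≫ p₂ = p₂` and pull-back past one flf tensor factor).
[cite: Markman2025SecantWeil, §6 p. 26 L34] -/
def tensorPullbackSndShearIso {L : A.X.left.Modules} (hL : IsFiniteLocallyFree L) :
    (tensorBifunctor (A.X ⊗ A.X).left).obj ((Scheme.Modules.pullback (snd A.X A.X).left).obj L) ⋙
        Scheme.Modules.pullback (shearSchemeIso A).hom ≅
      Scheme.Modules.pullback (shearSchemeIso A).hom ⋙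
        (tensorBifunctor (A.X ⊗ A.X).left).obj ((Scheme.Modules.pullback (snd A.X A.X).left).obj L) :=
  pullbackTensorNatIsoOfLeft (shearSchemeIso A).hom (hL.pullback _) ≪≫
    Functor.isoWhiskerLeft _ ((tensorBifunctor _).mapIso
      ((pullbackComp (shearSchemeIso A).hom (snd A.X A.X).left ≪≫ pullbackCongr (shearSchemeIso_hom_comp_snd A)).app L))

end Shear

/-! ### §3 The two rows for Markman's `Φ` -/

section Rows

variable (a : A.Points ℂ) (α : (A.dualOf Θ hΘ).Points ℂ) [HasDerivedCategory.{w₁} (A.X ⊗ A.X).left.Modules]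
  [HasDerivedCategory.{w₂} ((A.X ⊗ A.X) ⊗ (A.dualOf Θ hΘ).X).left.Modules]
  [HasDerivedCategory.{w₃} (A.X ⊗ (A.dualOf Θ hΘ).X).left.Modules]

/-- **ROW Φ-(i): `D⁺((t_a × 1)^*) ⋙ Φ ≅ Φ ⋙ D⁺((t_a × 1)^*)`** — translating the first factor of `A × A` passes through Markman's `Φ`
unchanged (`μ` commutes with `t_a × 1`; then the relative row (i)). Exactness instances of the two `(t_a × 1)^*` are binders
(`preservesFiniteLimits_pullback_fstTranslation`). [cite: Markman2025SecantWeil, §9.3 p. 71 L46–69] [cite: Mukai1981, §3 (3.1) p. 158] -/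
def markmanPhi_translationFst_iso [PreservesFiniteLimits (Scheme.Modules.pullback (fstTranslationIso A a A).hom)]
    [PreservesFiniteLimits (Scheme.Modules.pullback (fstTranslationIso A a (A.dualOf Θ hΘ)).hom)] :
    (Scheme.Modules.pullback (fstTranslationIso A a A).hom).mapDerivedCategoryPlus ⋙ markmanPhiPlus A hΘ hK ≅
      markmanPhiPlus A hΘ hK ⋙ (Scheme.Modules.pullback (fstTranslationIso A a (A.dualOf Θ hΘ)).hom).mapDerivedCategoryPlus := by
  haveI := preservesFiniteLimits_pullback_shear A
  let t := Scheme.Modules.pullback (fstTranslationIso A a A).hom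
  let sh := Scheme.Modules.pullback (shearSchemeIso A).hom
  let T := relativeIntegralTransformPlus A A (A.dualOf Θ hΘ) (Modules.dual (poincareSheaf A hΘ hK))
    (isFiniteLocallyFree_dual (isFiniteLocallyFree_poincareSheaf A hΘ hK)) (hasRank_dual (hasRank_poincareSheaf A hΘ hK))
  change t.mapDerivedCategoryPlus ⋙ sh.mapDerivedCategoryPlus ⋙ T ≅ (sh.mapDerivedCategoryPlus ⋙ T) ⋙ _
  exact (Functor.associator _ _ _).symm ≪≫
    Functor.isoWhiskerRight ((Functor.mapDerivedCategoryPlusCompIso t sh).symm ≪≫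
      Functor.mapDerivedCategoryPlusIsoOfIso _ _ (pullbackFstTranslationShearIso A a) ≪≫
      Functor.mapDerivedCategoryPlusCompIso sh t) T ≪≫
    Functor.associator _ _ _ ≪≫
    Functor.isoWhiskerLeft sh.mapDerivedCategoryPlus
      (relativeTransform_translationFst_iso A A (A.dualOf Θ hΘ) (Modules.dual (poincareSheaf A hΘ hK))
        (isFiniteLocallyFree_dual (isFiniteLocallyFree_poincareSheaf A hΘ hK)) (hasRank_dual (hasRank_poincareSheaf A hΘ hK)) a) ≪≫
    (Functor.associator _ _ _).symm

/-- **ROW Φ-(ii): `D⁺(p₂^*(P_α^∨) ⊗ –) ⋙ Φ ≅ Φ ⋙ D⁺((1 × t_α)^*)`** — twisting by the pulled-back dual Poincaré slice on the SECOND factor of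
`A × A` becomes translation of the `Â`-factor after `Φ` (`μ` fixes `p₂`; then the relative tensor row with the datum of §1).
Exactness instances are binders. [cite: Markman2025SecantWeil, §9.3 p. 71 L46–69] [cite: Mukai1981, §3 (3.1) p. 158] -/
def markmanPhi_twist_iso
    [((tensorBifunctor (A.X ⊗ A.X).left).obj ((Scheme.Modules.pullback (snd A.X A.X).left).obj (Modules.dual (linePt A hΘ hK α)))).Additive]
    [PreservesFiniteLimits ((tensorBifunctor (A.X ⊗ A.X).left).obj
      ((Scheme.Modules.pullback (snd A.X A.X).left).obj (Modules.dual (linePt A hΘ hK α))))]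
    [PreservesFiniteColimits ((tensorBifunctor (A.X ⊗ A.X).left).obj
      ((Scheme.Modules.pullback (snd A.X A.X).left).obj (Modules.dual (linePt A hΘ hK α))))]
    [PreservesFiniteLimits (Scheme.Modules.pullback (sndTranslationIso (A.dualOf Θ hΘ) α A).hom)] :
    ((tensorBifunctor (A.X ⊗ A.X).left).obj
        ((Scheme.Modules.pullback (snd A.X A.X).left).obj (Modules.dual (linePt A hΘ hK α)))).mapDerivedCategoryPlus ⋙
        markmanPhiPlus A hΘ hK ≅
      markmanPhiPlus A hΘ hK ⋙ (Scheme.Modules.pullback (sndTranslationIso (A.dualOf Θ hΘ) α A).hom).mapDerivedCategoryPlus := by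
  haveI := preservesFiniteLimits_pullback_shear A
  have hL : IsFiniteLocallyFree (Modules.dual (linePt A hΘ hK α)) := isFiniteLocallyFree_dual (isFiniteLocallyFree_linePt A hΘ hK α)
  let Tw := (tensorBifunctor (A.X ⊗ A.X).left).obj
    ((Scheme.Modules.pullback (snd A.X A.X).left).obj (Modules.dual (linePt A hΘ hK α)))
  let sh := Scheme.Modules.pullback (shearSchemeIso A).hom
  let T := relativeIntegralTransformPlus A A (A.dualOf Θ hΘ) (Modules.dual (poincareSheaf A hΘ hK))
    (isFiniteLocallyFree_dual (isFiniteLocallyFree_poincareSheaf A hΘ hK)) (hasRank_dual (hasRank_poincareSheaf A hΘ hK))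
  change Tw.mapDerivedCategoryPlus ⋙ sh.mapDerivedCategoryPlus ⋙ T ≅ (sh.mapDerivedCategoryPlus ⋙ T) ⋙ _
  exact (Functor.associator _ _ _).symm ≪≫
    Functor.isoWhiskerRight ((Functor.mapDerivedCategoryPlusCompIso Tw sh).symm ≪≫
      Functor.mapDerivedCategoryPlusIsoOfIso _ _ (tensorPullbackSndShearIso A hL) ≪≫
      Functor.mapDerivedCategoryPlusCompIso sh Tw) T ≪≫
    Functor.associator _ _ _ ≪≫
    Functor.isoWhiskerLeft sh.mapDerivedCategoryPlus
      (relativeTransform_twist_iso A A (A.dualOf Θ hΘ) (Modules.dual (poincareSheaf A hΘ hK))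
        (isFiniteLocallyFree_dual (isFiniteLocallyFree_poincareSheaf A hΘ hK)) (hasRank_dual (hasRank_poincareSheaf A hΘ hK)) α hL
        (pullbackSndTranslationDualPoincareSheafIso A hΘ hK α)) ≪≫
    (Functor.associator _ _ _).symm

/-- Objectwise form of ROW Φ-(i) (instances discharged). [cite: Markman2025SecantWeil, §9.3 p. 71 L46–69] -/
theorem nonempty_markmanPhi_translationFst_iso (E : DerivedCategory.Plus (A.X ⊗ A.X).left.Modules) :
    Nonempty ((markmanPhiPlus A hΘ hK).obj
        ((haveI := preservesFiniteLimits_pullback_fstTranslation A a A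
          (Scheme.Modules.pullback (fstTranslationIso A a A).hom).mapDerivedCategoryPlus).obj E) ≅
      (haveI := preservesFiniteLimits_pullback_fstTranslation A a (A.dualOf Θ hΘ)
       (Scheme.Modules.pullback (fstTranslationIso A a (A.dualOf Θ hΘ)).hom).mapDerivedCategoryPlus).obj
        ((markmanPhiPlus A hΘ hK).obj E)) :=
  haveI := preservesFiniteLimits_pullback_fstTranslation A a A
  haveI := preservesFiniteLimits_pullback_fstTranslation A a (A.dualOf Θ hΘ)
  ⟨(markmanPhi_translationFst_iso A hΘ hK a).app E⟩

/-- Objectwise form of ROW Φ-(ii) (instances discharged). [cite: Markman2025SecantWeil, §9.3 p. 71 L46–69] -/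
theorem nonempty_markmanPhi_twist_iso (E : DerivedCategory.Plus (A.X ⊗ A.X).left.Modules) :
    Nonempty ((markmanPhiPlus A hΘ hK).obj
        ((haveI := additive_tensorBifunctor_obj
            ((Scheme.Modules.pullback (snd A.X A.X).left).obj (Modules.dual (linePt A hΘ hK α)))
          haveI := (isInvertibleModule_of_hasRank_one
            ((isFiniteLocallyFree_dual (isFiniteLocallyFree_linePt A hΘ hK α)).pullback (snd A.X A.X).left)
            (hasRank_pullback _ (hasRank_dual (hasRank_linePt A hΘ hK α)))).preservesFiniteLimits
          haveI := (isInvertibleModule_of_hasRank_one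
            ((isFiniteLocallyFree_dual (isFiniteLocallyFree_linePt A hΘ hK α)).pullback (snd A.X A.X).left)
            (hasRank_pullback _ (hasRank_dual (hasRank_linePt A hΘ hK α)))).preservesFiniteColimits
          ((tensorBifunctor (A.X ⊗ A.X).left).obj
            ((Scheme.Modules.pullback (snd A.X A.X).left).obj (Modules.dual (linePt A hΘ hK α)))).mapDerivedCategoryPlus).obj E) ≅
      (haveI := preservesFiniteLimits_pullback_sndTranslation (A.dualOf Θ hΘ) α A
       (Scheme.Modules.pullback (sndTranslationIso (A.dualOf Θ hΘ) α A).hom).mapDerivedCategoryPlus).obj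
        ((markmanPhiPlus A hΘ hK).obj E)) :=
  haveI := additive_tensorBifunctor_obj
    ((Scheme.Modules.pullback (snd A.X A.X).left).obj (Modules.dual (linePt A hΘ hK α)))
  haveI := (isInvertibleModule_of_hasRank_one
    ((isFiniteLocallyFree_dual (isFiniteLocallyFree_linePt A hΘ hK α)).pullback (snd A.X A.X).left)
    (hasRank_pullback _ (hasRank_dual (hasRank_linePt A hΘ hK α)))).preservesFiniteLimits
  haveI := (isInvertibleModule_of_hasRank_one
    ((isFiniteLocallyFree_dual (isFiniteLocallyFree_linePt A hΘ hK α)).pullback (snd A.X A.X).left)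
    (hasRank_pullback _ (hasRank_dual (hasRank_linePt A hΘ hK α)))).preservesFiniteColimits
  haveI := preservesFiniteLimits_pullback_sndTranslation (A.dualOf Θ hΘ) α A
  ⟨(markmanPhi_twist_iso A hΘ hK α).app E⟩

/-- **ROW Φ-(iii) (the two rows composed at a point `p = (a, α)` of `A × Â`):
`D⁺(p₂^*(P_α^∨) ⊗ –) ⋙ D⁺((t_a × 1)^*) ⋙ Φ ≅ Φ ⋙ D⁺(t_p^*)`** — twisting the second factor of `A × A` by `P_α^∨` and translating the
first by `a` becomes, after Markman's `Φ`, translation by `p` on `A × Â` (`t_p = (t_a × 1) ≫ (1 × t_α)`). With `a = p ≫ pr₁`, `α = p ≫ pr₂`;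
exactness instances are binders (`preservesFiniteLimits_pullback_fstTranslation ∕ _prodTranslation`, `isInvertibleModule_of_hasRank_one`).
[cite: Markman2025SecantWeil, §9.3 p. 71 L46–69] [cite: Mukai1981, §3 (3.1) p. 158] -/
def markmanPhi_exchange_iso (p : (A.prod (A.dualOf Θ hΘ)).Points ℂ)
    [((tensorBifunctor (A.X ⊗ A.X).left).obj ((Scheme.Modules.pullback (snd A.X A.X).left).obj
      (Modules.dual (linePt A hΘ hK (p ≫ snd A.X (A.dualOf Θ hΘ).X))))).Additive]
    [PreservesFiniteLimits ((tensorBifunctor (A.X ⊗ A.X).left).obj ((Scheme.Modules.pullback (snd A.X A.X).left).obj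
      (Modules.dual (linePt A hΘ hK (p ≫ snd A.X (A.dualOf Θ hΘ).X)))))]
    [PreservesFiniteColimits ((tensorBifunctor (A.X ⊗ A.X).left).obj ((Scheme.Modules.pullback (snd A.X A.X).left).obj
      (Modules.dual (linePt A hΘ hK (p ≫ snd A.X (A.dualOf Θ hΘ).X)))))]
    [PreservesFiniteLimits (Scheme.Modules.pullback (fstTranslationIso A (p ≫ fst A.X (A.dualOf Θ hΘ).X) A).hom)]
    [PreservesFiniteLimits (Scheme.Modules.pullback (prodTranslationSchemeIso A (A.dualOf Θ hΘ) p).hom)] :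
    (((tensorBifunctor (A.X ⊗ A.X).left).obj ((Scheme.Modules.pullback (snd A.X A.X).left).obj
        (Modules.dual (linePt A hΘ hK (p ≫ snd A.X (A.dualOf Θ hΘ).X))))).mapDerivedCategoryPlus ⋙
      (Scheme.Modules.pullback (fstTranslationIso A (p ≫ fst A.X (A.dualOf Θ hΘ).X) A).hom).mapDerivedCategoryPlus) ⋙
        markmanPhiPlus A hΘ hK ≅
      markmanPhiPlus A hΘ hK ⋙ (Scheme.Modules.pullback (prodTranslationSchemeIso A (A.dualOf Θ hΘ) p).hom).mapDerivedCategoryPlus := by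
  haveI := preservesFiniteLimits_pullback_fstTranslation A (p ≫ fst A.X (A.dualOf Θ hΘ).X) (A.dualOf Θ hΘ)
  haveI := preservesFiniteLimits_pullback_sndTranslation (A.dualOf Θ hΘ) (p ≫ snd A.X (A.dualOf Θ hΘ).X) A
  let Tw := (tensorBifunctor (A.X ⊗ A.X).left).obj ((Scheme.Modules.pullback (snd A.X A.X).left).obj
    (Modules.dual (linePt A hΘ hK (p ≫ snd A.X (A.dualOf Θ hΘ).X))))
  let t' := Scheme.Modules.pullback (fstTranslationIso A (p ≫ fst A.X (A.dualOf Θ hΘ).X) (A.dualOf Θ hΘ)).hom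
  let s := Scheme.Modules.pullback (sndTranslationIso (A.dualOf Θ hΘ) (p ≫ snd A.X (A.dualOf Θ hΘ).X) A).hom
  exact Functor.associator _ _ _ ≪≫
    Functor.isoWhiskerLeft Tw.mapDerivedCategoryPlus (markmanPhi_translationFst_iso A hΘ hK (p ≫ fst A.X (A.dualOf Θ hΘ).X)) ≪≫
    (Functor.associator _ _ _).symm ≪≫
    Functor.isoWhiskerRight (markmanPhi_twist_iso A hΘ hK (p ≫ snd A.X (A.dualOf Θ hΘ).X)) t'.mapDerivedCategoryPlus ≪≫
    Functor.associator _ _ _ ≪≫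
    Functor.isoWhiskerLeft (markmanPhiPlus A hΘ hK) ((Functor.mapDerivedCategoryPlusCompIso s t').symm ≪≫
      Functor.mapDerivedCategoryPlusIsoOfIso _ _ (pullbackSndTranslationFstTranslationIso A (A.dualOf Θ hΘ) p))

/-- Objectwise form of ROW Φ-(iii) (instances discharged): `Φ((t_a × 1)^*(p₂^*P_α^∨ ⊗ E)) ≅ t_p^*Φ(E)` in `D⁺(Mod 𝒪_{A×Â})`.
[cite: Markman2025SecantWeil, §9.3 p. 71 L46–69] -/
theorem nonempty_markmanPhi_exchange_iso (p : (A.prod (A.dualOf Θ hΘ)).Points ℂ) (E : DerivedCategory.Plus (A.X ⊗ A.X).left.Modules) :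
    Nonempty ((markmanPhiPlus A hΘ hK).obj
        ((haveI := preservesFiniteLimits_pullback_fstTranslation A (p ≫ fst A.X (A.dualOf Θ hΘ).X) A
          (Scheme.Modules.pullback (fstTranslationIso A (p ≫ fst A.X (A.dualOf Θ hΘ).X) A).hom).mapDerivedCategoryPlus).obj
          ((haveI := additive_tensorBifunctor_obj ((Scheme.Modules.pullback (snd A.X A.X).left).obj
              (Modules.dual (linePt A hΘ hK (p ≫ snd A.X (A.dualOf Θ hΘ).X))))
            haveI := (isInvertibleModule_of_hasRank_one
              ((isFiniteLocallyFree_dual (isFiniteLocallyFree_linePt A hΘ hK (p ≫ snd A.X (A.dualOf Θ hΘ).X))).pullback (snd A.X A.X).left)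
              (hasRank_pullback _ (hasRank_dual (hasRank_linePt A hΘ hK (p ≫ snd A.X (A.dualOf Θ hΘ).X))))).preservesFiniteLimits
            haveI := (isInvertibleModule_of_hasRank_one
              ((isFiniteLocallyFree_dual (isFiniteLocallyFree_linePt A hΘ hK (p ≫ snd A.X (A.dualOf Θ hΘ).X))).pullback (snd A.X A.X).left)
              (hasRank_pullback _ (hasRank_dual (hasRank_linePt A hΘ hK (p ≫ snd A.X (A.dualOf Θ hΘ).X))))).preservesFiniteColimits
            ((tensorBifunctor (A.X ⊗ A.X).left).obj ((Scheme.Modules.pullback (snd A.X A.X).left).obj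
              (Modules.dual (linePt A hΘ hK (p ≫ snd A.X (A.dualOf Θ hΘ).X))))).mapDerivedCategoryPlus).obj E)) ≅
      (haveI := preservesFiniteLimits_pullback_prodTranslation A (A.dualOf Θ hΘ) p
       (Scheme.Modules.pullback (prodTranslationSchemeIso A (A.dualOf Θ hΘ) p).hom).mapDerivedCategoryPlus).obj
        ((markmanPhiPlus A hΘ hK).obj E)) :=
  haveI := additive_tensorBifunctor_obj ((Scheme.Modules.pullback (snd A.X A.X).left).obj
    (Modules.dual (linePt A hΘ hK (p ≫ snd A.X (A.dualOf Θ hΘ).X))))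
  haveI := (isInvertibleModule_of_hasRank_one
    ((isFiniteLocallyFree_dual (isFiniteLocallyFree_linePt A hΘ hK (p ≫ snd A.X (A.dualOf Θ hΘ).X))).pullback (snd A.X A.X).left)
    (hasRank_pullback _ (hasRank_dual (hasRank_linePt A hΘ hK (p ≫ snd A.X (A.dualOf Θ hΘ).X))))).preservesFiniteLimits
  haveI := (isInvertibleModule_of_hasRank_one
    ((isFiniteLocallyFree_dual (isFiniteLocallyFree_linePt A hΘ hK (p ≫ snd A.X (A.dualOf Θ hΘ).X))).pullback (snd A.X A.X).left)
    (hasRank_pullback _ (hasRank_dual (hasRank_linePt A hΘ hK (p ≫ snd A.X (A.dualOf Θ hΘ).X))))).preservesFiniteColimits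
  haveI := preservesFiniteLimits_pullback_fstTranslation A (p ≫ fst A.X (A.dualOf Θ hΘ).X) A
  haveI := preservesFiniteLimits_pullback_prodTranslation A (A.dualOf Θ hΘ) p
  ⟨(markmanPhi_exchange_iso A hΘ hK p).app E⟩

end Rows

end Literature.AlgebraicGeometry.AbelianVarieties

end
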